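import Summits.QuantumFields.YangMills.Theorems.BalabanUVNodesN12ClassLetterGeometryOfRecord
import Summits.QuantumFields.YangMills.Theorems.BalabanUVNodesN12RightInverseLetterOfForest
import Summits.QuantumFields.YangMills.Theorems.BalabanUVNodesN12ForestSlice
import Literature.MathematicalPhysics.QuantumFieldTheory.Balaban1983to89.B15Prop1ClosedGuardUniformRadius
import HarnessLib

/-!
# BalabanUVNodes ∕ N12 — THE w1 LINEAGE's (J0′) CHART THEOREM AT THE RECORD's `𝐁_k(Z)`, WITH THE CLASS LETTERS AND THE FOREST DISCHARGED
# ([Balaban1985Variational] Thm 1 p. 279, (1)–(2), (6)–(7) pp. 277–279, (16)–(18) p. 280, Sect. C (44)–(48) p. 285, Prop. 9 (190) p. 309; [Balaban1989LargeFieldI] (1.74) p. 192, Prop. 1 p. 194;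
# [Balaban1989LargeFieldII] (1.9) p. 358; [Balaban1988Convergent] (2.2) p. 255, (2.10)–(2.13) pp. 256–257; [Balaban1985Averaging] Prop. 2 p. 26)

Cell `pub-ymgap` (HUMAN RULINGS D-0062 ∕ D-0149), WIDTH SEAT `pub-ymgap-dag-n12-w1` g4 (node N12 = [B15]; key K1⁹ `stmt-QuantumFields-27364`, `--kind proof --supports … --as helper`;
count-neutral).  THEOREMS ONLY (0 `def`, 0 `instance`, 0 `sorry`); one proof term over: the lineage's chart theorem with (45) discharged
(`…N12RightInverseLetterOfForest.hMin_atRecord_of_node00Letters_thm1AtBase_central_surj`, g3 p633254), Part 3 of the class-letter discharge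
(`…N12ClassLetterGeometryOfRecord.classLetters_closure_regMSCoPOfRecord_Bj`, g4), and dag-n12-w3's rooted forest + axial slice at `𝐁_k(Z)` (`…N12ForestSlice.exists_forest_slice_Bj`).

WHY.  After g3, the lineage's best theorem displayed per base field `V_k ∈ K`: a minimiser `U₀` + the two (0.4) guards · a rooted forest (F1)(F2)(F3) with its slice `S` and the two
definitional letters `a` (complex Wilson action along the chart) and `Φ₀` (logarithmic datum coordinates) · dag-n12-w3's guards `t₀` · surjectivity of `DΦ_{U₀}(0)` · (β) `hposN` ·
(T1@q₀) — and, once for all base fields, the three CLASS letters (`IsClosed reg'`, `closure reg ⊆ reg'`, `ContinuousOn (𝐁-averages) reg'`).  THIS FILE specialises to the record's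
objects `𝐁 := Bj ν.M₁ Z k`, `{Ω_n} := maxDomT ν.M₁ Z`, `reg' := closure (Node00.regMSCoPOfRecord F 2 ν Kt kc (maxDomT ν.M₁ Z))` and removes everything that is now a theorem: the class
letters (Part 3, modulo numerics), the forest and its slice (dag-n12-w3, any `Z`), `a` and `Φ₀` (instantiated by their formulas).  What the consumer supplies per base field is print's own:
(E) the (2.12) minimiser `U₀` with the guards, the surjectivity of `DΦ_{U₀}(0)` (dag-n10-w1's letter; hypothesis-free near the flat configuration), (β) — now asked on EVERY forest axial
slice through the constrained towers (the file picks dag-n12-w3's) — and (T1@q₀) = [15] Thm 1 at the base datum over the CLOSURE of NODE 00's class (central reading); plus the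
numerics `0 < εreg`, the [B7] Prop. 2 window at `α₀ := 2L²εreg`, the floor `(d+14)·L ≤ M₁`, `M₁L^k ∣ N₀`, `1 ≤ k ≤ kc + 1`.

CONTENTS.  ★★★ `hMin_atRecord_Bj_of_printLetters` — (J0′) `hMin` in the lineage's output shape (`∃ R > 0, ∀ V_k ∈ K, …`) from the letters above; ★★★ `hMinC_atRecord_Bj_of_printLetters` —
the same in the `hMinC` shape of dag-n12-c's `…ClosedGuardUniformRadius.…Compact` sockets (letters asked on the closed small-field guard, conclusion on every compact subset of it);
★★★ `hMin_closedGuard_atRecord_Bj_of_printLetters` — read once on the compact closed guard: ONE radius for all guarded base fields (LOCATED-R recipe pre-applied).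

HONEST FRAMING.  One composition; (E), surjectivity, (β), (T1@q₀) and the numerics stay DISPLAYED; nothing of Bałaban's estimates asserted; N12 NOT discharged; K1⁹ NOT closed; counts
unmoved; one finite 𝕋⁴ programme at fixed ε — R4 closes the conditional rung `BalabanLadder.UV` only; the Yang–Mills mass gap (Clay) is NOT proved by any of this; nothing
continuum ∕ ℝ⁴ ∕ OS.
-/

noncomputable section

namespace Summit.QuantumFields.YangMills.BalabanUVNodes.N12MinimiserFamilyAtRecordBj

open scoped BigOperators Matrix.Norms.L2Operator Topology
open Literature.MathematicalPhysics.QuantumFieldTheory.Balaban1983to89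
open T4Continuum
open B15DeterminingSets GaugeField
open ExpMeanLog (expMeanLogSU deltaSU)
open T4AdjointCovarianceUnitary (lieSU)
open Node00
open B15SU2ChartHolomorphic (genE)
open B15Prop1AnalyticExtClause (cplxVec)
open B15Prop1ChartCalculusSU2 (E3)
open T4CubeChartGnomonic (SU2)
open B14.Eq213DetSet (Bj maxDomT Bj_of_gt)
open B14.Eq213MaximalDomains (side)
open Summit.QuantumFields.YangMills.Theorems.BlockAvgCorrector (stokesConst)
open Summit.QuantumFields.YangMills.BalabanUVNodes.N12RightInverseLetterOfForest (hMin_atRecord_of_node00Letters_thm1AtBase_central_surj)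
open Summit.QuantumFields.YangMills.BalabanUVNodes.N12ClassLetterGeometryOfRecord (classLetters_closure_regMSCoPOfRecord_Bj)
open Summit.QuantumFields.YangMills.BalabanUVNodes.N12ForestSlice (exists_forest_slice_Bj)
open Literature.MathematicalPhysics.QuantumFieldTheory.BalabanImbrieJaffe1984to88.BIJ85Eq453GaugeField (qsstarGIter0)
open B15AveragingHolomorphic (iterMh)
open B15SU2ChartHolomorphic (expMulC logCoordC)
open B15ShellGauge193 (shellGauge)
open B15Extension193 (extend)
open B16Sect1Backgrounds (toMS expMul)
open B15Prop1ChartSU2 (su2Chart)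
open Metric (ball)
open B15Prop1ClosedGuardUniformRadius (forall_of_forall_isCompact_subset)

variable {F : T4Family} {k : ℕ}

/-- ★★★ **(J0′) `hMin` AT THE RECORD's `𝐁_k(Z)` FROM PRINT's PER-BASE-FIELD LETTERS AND NUMERICS** — the w1 lineage's chart theorem with the class letters (Part 3), the rooted
forest and its axial slice (dag-n12-w3), and the definitional letters `a`, `Φ₀` discharged.  Per base field `V_k ∈ K` the consumer supplies: the (2.12) minimiser `U₀` of the datum
`Ū(Q^{s*}_k(ext V_k))` in NODE 00's class with the two (0.4) guards and dag-n12-w3's plaquette guards `t₀`; the surjectivity of `DΦ_{U₀}(0)`; (β) on every forest axial slice `S`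
through the constrained towers (real second variation of the Lagrangian positive on the real kernel of `Q(U₀)` in `S`); (T1@q₀) over the closure of the class (datum-preserving =
tower-central gauges).  Numerics: `0 < εreg`, `C₀(d)·2L²εreg ≤ ⅓`, `2·2L²εreg ≤ c′₂`, `(d+14)·L ≤ M₁`, `M₁L^k ∣ N₀`, `1 ≤ k ≤ kc + 1`, `k ≤ m + K`.
[cite: Balaban1985Variational, Thm 1 p.279, (1)–(2), (6)–(7) pp.277–279, (16)–(18) p.280, Sect. C (44)–(48) p.285, (82)–(83) p.290, Prop. 8 p.305, Prop. 9 (190) p.309; Balaban1985RegularSpaces, (1.19) p.79; Balaban1989LargeFieldI, (1.74) p.192, Prop. 1 p.194; Balaban1989LargeFieldII, (1.9) p.358, (1.12) p.359; Balaban1988Convergent, (2.2) p.255, (2.10)–(2.13) pp.256–257; Balaban1985Averaging, Prop. 2 (52)–(54) p.26] -/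
theorem hMin_atRecord_Bj_of_printLetters (ν : Node00.Stage7Numerics) (Kt kc : ℕ) (Z : Set (Site (F.P Kt) 0))
    (Λ : Set (Site (F.P Kt) k)) (lo hi : Fin (F.P Kt).d → ℤ) (hk : k ≤ (F.P Kt).m + (F.P Kt).K) (hk1 : 1 ≤ k) (hkc : k ≤ kc + 1)
    (hdiv : side (F.P Kt).L ν.M₁ k ∣ (F.P Kt).sitesPerDir 0) (hfloor : ((F.P Kt).d + 14) * (F.P Kt).L ≤ ν.M₁) (hε : 0 < ν.εreg)
    (hα3 : (143 * (((((F.P Kt).d + 4 : ℕ) : ℝ)) ^ 2 / 4) ^ 2) * (2 * ((F.P Kt).L : ℝ) ^ 2 * ν.εreg) ≤ 1 / 3)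
    (hα2 : 2 * (2 * ((F.P Kt).L : ℝ) ^ 2 * ν.εreg) ≤ 2 * deltaSU (Fin 2) / ((((F.P Kt).d + 4) * (F.P Kt).L : ℕ) : ℝ) ^ 2)
    (ext : GaugeField (F.P Kt) k SU2 → GaugeField (F.P Kt) k SU2) (hext : ∀ W, ext W = extend Λ (shellGauge W lo hi) W)
    {K : Set (GaugeField (F.P Kt) k SU2)} (hK : IsCompact K) {𝓐₀ : ℝ} (h𝓐₀ : 1 < 𝓐₀)
    (hbase : ∀ Vk ∈ K, ∃ U₀ : GaugeField (F.P Kt) 0 SU2,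
      IsMinimizer (Node00.avOfRecord F 2 Kt) (Node00.regMSCoPOfRecord F 2 ν Kt kc (maxDomT ν.M₁ Z)) (Bj ν.M₁ Z k)
        (avgFamily (Node00.avOfRecord F 2 Kt) (qsstarGIter0 k (ext Vk))) U₀ ∧
      SmallBelow (Node00.avOfRecord F 2 Kt) k (qsstarGIter0 k (ext Vk)) ∧
      SmallBelow (Node00.avOfRecord F 2 Kt) k U₀ ∧
      -- guards in dag-n12-w3's currency and the DISPLAYED surjectivity of `DΦ_{U₀}(0)`
      (∃ t₀ : ℝ, 0 < t₀ ∧ stokesConst (F.P Kt) * t₀ < deltaSU (Fin 2) ∧ ∀ i, i < k → PlaqSmall t₀ (Averaging.iter (Node00.avOfRecord F 2 Kt) i U₀)) ∧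
      Function.Surjective (fderiv ℝ (Node00.msChart F 2 Kt k (Bj ν.M₁ Z k) (avgFamily (Node00.avOfRecord F 2 Kt) U₀) U₀) 0) ∧
      -- DISPLAYED (β) ON EVERY FOREST AXIAL SLICE through the constrained towers of `𝐁_k(Z)`
      (∀ (S : Submodule ℂ (VecField (F.P Kt) 0 (EuclideanSpace ℂ (Fin 3)))) (path : Site (F.P Kt) 0 → List (LStep (F.P Kt) 0)),
        (∀ x, ∀ s ∈ path x, ∃ x' x'' : Site (F.P Kt) 0, path x'' = path x' ++ [s] ∧
          (s.fwd = true → s.bond.src = x' ∧ s.bond.tgt = x'') ∧ (s.fwd = false → s.bond.src = x'' ∧ s.bond.tgt = x')) →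
        (∀ j, j ≤ k → ∀ c ∈ bondsOf (Bj ν.M₁ Z k j), path (embIter j c.src) = [] ∧ path (embIter j c.tgt) = []) →
        (∀ X : VecField (F.P Kt) 0 (EuclideanSpace ℂ (Fin 3)), X ∈ S ↔ ∀ x, ∀ s ∈ path x, X s.bond = 0) →
        ∀ ℓ₀ : (Fin (constrCard (Bj ν.M₁ Z k) k) → EuclideanSpace ℂ (Fin 3)) →L[ℂ] ℂ,
          fderiv ℂ (fun X : S => ∑ p : Plaq (F.P Kt) 0, (1 - (expMulC (X : VecField (F.P Kt) 0 (EuclideanSpace ℂ (Fin 3))) (coeField U₀) ⟨p.src, p.μ⟩ *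
            expMulC (X : VecField (F.P Kt) 0 (EuclideanSpace ℂ (Fin 3))) (coeField U₀) ⟨p.src.shift p.μ, p.ν⟩ *
            Matrix.adjugate (expMulC (X : VecField (F.P Kt) 0 (EuclideanSpace ℂ (Fin 3))) (coeField U₀) ⟨p.src.shift p.ν, p.μ⟩) *
            Matrix.adjugate (expMulC (X : VecField (F.P Kt) 0 (EuclideanSpace ℂ (Fin 3))) (coeField U₀) ⟨p.src, p.ν⟩)).trace / 2)) 0 =
            ℓ₀.comp (fderiv ℂ (fun (X : S) (i : Fin (constrCard (Bj ν.M₁ Z k) k)) =>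
              logCoordC (star ((avgFamily (Node00.avOfRecord F 2 Kt) (qsstarGIter0 k (ext Vk))
                ((constrEnum (Bj ν.M₁ Z k) k).symm i).1 ((constrEnum (Bj ν.M₁ Z k) k).symm i).2.1 : SU2) : Matrix (Fin 2) (Fin 2) ℂ) *
                iterMh ((constrEnum (Bj ν.M₁ Z k) k).symm i).1 (expMulC (X : VecField (F.P Kt) 0 (EuclideanSpace ℂ (Fin 3))) (coeField U₀))
                  ((constrEnum (Bj ν.M₁ Z k) k).symm i).2.1)) 0) →
          ∀ (p : VecField (F.P Kt) 0 E3) (hp : cplxVec p ∈ S), p ≠ 0 →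
            (∀ i : Fin (constrCard (Bj ν.M₁ Z k) k), dIterL ((constrEnum (Bj ν.M₁ Z k) k).symm i).1 (coeField U₀)
              (fun b => (∑ a : Fin 3, ((p b a : ℝ) : ℂ) • genE a) * ((U₀ b : SU2) : Matrix (Fin 2) (Fin 2) ℂ)) ((constrEnum (Bj ν.M₁ Z k) k).symm i).2.1 = 0) →
            0 < deriv (deriv (fun t : ℝ => wilsonAction4 (expMul su2Chart (t • p) U₀) -
              (ℓ₀ ((fun (X : S) (i : Fin (constrCard (Bj ν.M₁ Z k) k)) =>
                logCoordC (star ((avgFamily (Node00.avOfRecord F 2 Kt) (qsstarGIter0 k (ext Vk))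
                  ((constrEnum (Bj ν.M₁ Z k) k).symm i).1 ((constrEnum (Bj ν.M₁ Z k) k).symm i).2.1 : SU2) : Matrix (Fin 2) (Fin 2) ℂ) *
                  iterMh ((constrEnum (Bj ν.M₁ Z k) k).symm i).1 (expMulC (X : VecField (F.P Kt) 0 (EuclideanSpace ℂ (Fin 3))) (coeField U₀))
                    ((constrEnum (Bj ν.M₁ Z k) k).symm i).2.1)) ((t : ℂ) • ⟨cplxVec p, hp⟩))).re)) 0) ∧
      -- DISPLAYED (T1@q₀) over the CLOSURE of NODE 00's class: the tower-central orbit of `U₀` is the unique minimal orbit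
      (∀ U ∈ closure (Node00.regMSCoPOfRecord F 2 ν Kt kc (maxDomT ν.M₁ Z)),
        AgreeOn (Bj ν.M₁ Z k) (avgFamily (Node00.avOfRecord F 2 Kt) U) (avgFamily (Node00.avOfRecord F 2 Kt) (qsstarGIter0 k (ext Vk))) →
        wilsonAction4 U ≤ wilsonAction4 U₀ →
          ∃ u : GaugeTransf (F.P Kt) 0 SU2, (∀ j, j ≤ k → ∀ b ∈ bondsOf (Bj ν.M₁ Z k j),
            toMS u j b.src = toMS u j b.tgt ∧ ∀ g : SU2, toMS u j b.src * g = g * toMS u j b.src) ∧ gaugeAct u U = U₀)) :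
    ∃ R : ℝ, 0 < R ∧ ∀ Vk ∈ K,
      ∃ Ũ : VecField (F.P Kt) k (EuclideanSpace ℂ (Fin 3)) × VecField (F.P Kt) k (EuclideanSpace ℂ (Fin 3)) → PBond (F.P Kt) 0 → Matrix (Fin 2) (Fin 2) ℂ,
        (∀ b i j, DifferentiableOn ℂ (fun z => Ũ z b i j) (ball 0 R)) ∧
        (∀ z ∈ ball (0 : VecField (F.P Kt) k (EuclideanSpace ℂ (Fin 3)) × VecField (F.P Kt) k (EuclideanSpace ℂ (Fin 3))) R, ∀ b i j, ‖Ũ z b i j‖ ≤ 𝓐₀) ∧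
        ∀ p B' : VecField (F.P Kt) k E3, ‖p‖ < R → ‖B'‖ < R → ∃ U' : GaugeField (F.P Kt) 0 SU2,
          (∀ b, Ũ (cplxVec p, cplxVec B') b = ((U' b : SU2) : Matrix (Fin 2) (Fin 2) ℂ)) ∧
            IsMinimizer (Node00.avOfRecord F 2 Kt) (Node00.regMSCoPOfRecord F 2 ν Kt kc (maxDomT ν.M₁ Z)) (Bj ν.M₁ Z k)
              (avgFamily (Node00.avOfRecord F 2 Kt) (qsstarGIter0 k (expMul su2Chart B' (ext (expMul su2Chart p Vk))))) U' := by
  have hM : 1 ≤ ν.M₁ := le_trans (Nat.succ_le_of_lt (Nat.mul_pos (Nat.succ_pos _) (F.P Kt).L_pos)) hfloor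
  obtain ⟨hreg', hcl, hDreg'⟩ :=
    classLetters_closure_regMSCoPOfRecord_Bj (F := F) (N := 2) (K := Kt) ν hε hk hdiv hfloor Z kc hkc hα3 hα2
  refine hMin_atRecord_of_node00Letters_thm1AtBase_central_surj ν Kt kc (maxDomT ν.M₁ Z) Λ lo hi (Bj ν.M₁ Z k) (fun j hj => Bj_of_gt hj) hk ext hext hK h𝓐₀
    (closure (Node00.regMSCoPOfRecord F 2 ν Kt kc (maxDomT ν.M₁ Z))) hreg' hcl hDreg' fun Vk hVk => ?_
  obtain ⟨U₀, hmin, hsbQ, hsbU, hguards, hsurj, hβ, hT1⟩ := hbase Vk hVk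
  obtain ⟨path, S, hF1, hF2, -, hF3, -⟩ := exists_forest_slice_Bj (P := F.P Kt) (M₁ := ν.M₁) (Z := Z) hk hk1 hM hdiv
  exact ⟨U₀, S, path, _, _, hmin, hsbQ, hsbU, hF1, hF2, hF3, fun _ => rfl, fun _ _ => rfl, hguards, hsurj, hβ S path hF1 hF2 hF3, hT1⟩


/-- ★★★ **THE SAME IN THE `hMinC` SHAPE OF THE LANE's `…Compact` SOCKETS** (`B15Prop1ClosedGuardUniformRadius.…_ofMinimiserFamilyCompact` and successors: «for every compact `K` inside
the closed guard, `∃ R > 0, ∀ V_k ∈ K, …`»): the consumer supplies print's per-base-field letters for every base field of the CLOSED small-field guard `{∀ p ∈ G, |V_k(∂p) − 1| ≤ eR}`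
(any plaquette set `G`, any `eR`), and gets the compact-uniform (J0′) letter on every compact subset of the guard.  One line over `hMin_atRecord_Bj_of_printLetters`.
[cite: Balaban1989LargeFieldI, (1.74) p.192, Prop. 1 p.194 (last clause); Balaban1985Variational, Thm 1 p.279, (7) p.278, Prop. 9 (190) p.309; Balaban1988Convergent, (2.12)–(2.13) pp.256–257] -/
theorem hMinC_atRecord_Bj_of_printLetters (ν : Node00.Stage7Numerics) (Kt kc : ℕ) (Z : Set (Site (F.P Kt) 0))
    (Λ : Set (Site (F.P Kt) k)) (lo hi : Fin (F.P Kt).d → ℤ) (hk : k ≤ (F.P Kt).m + (F.P Kt).K) (hk1 : 1 ≤ k) (hkc : k ≤ kc + 1)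
    (hdiv : side (F.P Kt).L ν.M₁ k ∣ (F.P Kt).sitesPerDir 0) (hfloor : ((F.P Kt).d + 14) * (F.P Kt).L ≤ ν.M₁) (hε : 0 < ν.εreg)
    (hα3 : (143 * (((((F.P Kt).d + 4 : ℕ) : ℝ)) ^ 2 / 4) ^ 2) * (2 * ((F.P Kt).L : ℝ) ^ 2 * ν.εreg) ≤ 1 / 3)
    (hα2 : 2 * (2 * ((F.P Kt).L : ℝ) ^ 2 * ν.εreg) ≤ 2 * deltaSU (Fin 2) / ((((F.P Kt).d + 4) * (F.P Kt).L : ℕ) : ℝ) ^ 2)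
    (ext : GaugeField (F.P Kt) k SU2 → GaugeField (F.P Kt) k SU2) (hext : ∀ W, ext W = extend Λ (shellGauge W lo hi) W)
    {𝓐₀ : ℝ} (h𝓐₀ : 1 < 𝓐₀) (G : Set (Plaq (F.P Kt) k)) (eR : ℝ)
    (hletters : ∀ Vk : GaugeField (F.P Kt) k SU2, (∀ p ∈ G, dist1 (GaugeField.plaqHol Vk p) ≤ eR) → ∃ U₀ : GaugeField (F.P Kt) 0 SU2,
      IsMinimizer (Node00.avOfRecord F 2 Kt) (Node00.regMSCoPOfRecord F 2 ν Kt kc (maxDomT ν.M₁ Z)) (Bj ν.M₁ Z k)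
        (avgFamily (Node00.avOfRecord F 2 Kt) (qsstarGIter0 k (ext Vk))) U₀ ∧
      SmallBelow (Node00.avOfRecord F 2 Kt) k (qsstarGIter0 k (ext Vk)) ∧
      SmallBelow (Node00.avOfRecord F 2 Kt) k U₀ ∧
      -- guards in dag-n12-w3's currency and the DISPLAYED surjectivity of `DΦ_{U₀}(0)`
      (∃ t₀ : ℝ, 0 < t₀ ∧ stokesConst (F.P Kt) * t₀ < deltaSU (Fin 2) ∧ ∀ i, i < k → PlaqSmall t₀ (Averaging.iter (Node00.avOfRecord F 2 Kt) i U₀)) ∧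
      Function.Surjective (fderiv ℝ (Node00.msChart F 2 Kt k (Bj ν.M₁ Z k) (avgFamily (Node00.avOfRecord F 2 Kt) U₀) U₀) 0) ∧
      -- DISPLAYED (β) ON EVERY FOREST AXIAL SLICE through the constrained towers of `𝐁_k(Z)`
      (∀ (S : Submodule ℂ (VecField (F.P Kt) 0 (EuclideanSpace ℂ (Fin 3)))) (path : Site (F.P Kt) 0 → List (LStep (F.P Kt) 0)),
        (∀ x, ∀ s ∈ path x, ∃ x' x'' : Site (F.P Kt) 0, path x'' = path x' ++ [s] ∧
          (s.fwd = true → s.bond.src = x' ∧ s.bond.tgt = x'') ∧ (s.fwd = false → s.bond.src = x'' ∧ s.bond.tgt = x')) →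
        (∀ j, j ≤ k → ∀ c ∈ bondsOf (Bj ν.M₁ Z k j), path (embIter j c.src) = [] ∧ path (embIter j c.tgt) = []) →
        (∀ X : VecField (F.P Kt) 0 (EuclideanSpace ℂ (Fin 3)), X ∈ S ↔ ∀ x, ∀ s ∈ path x, X s.bond = 0) →
        ∀ ℓ₀ : (Fin (constrCard (Bj ν.M₁ Z k) k) → EuclideanSpace ℂ (Fin 3)) →L[ℂ] ℂ,
          fderiv ℂ (fun X : S => ∑ p : Plaq (F.P Kt) 0, (1 - (expMulC (X : VecField (F.P Kt) 0 (EuclideanSpace ℂ (Fin 3))) (coeField U₀) ⟨p.src, p.μ⟩ *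
            expMulC (X : VecField (F.P Kt) 0 (EuclideanSpace ℂ (Fin 3))) (coeField U₀) ⟨p.src.shift p.μ, p.ν⟩ *
            Matrix.adjugate (expMulC (X : VecField (F.P Kt) 0 (EuclideanSpace ℂ (Fin 3))) (coeField U₀) ⟨p.src.shift p.ν, p.μ⟩) *
            Matrix.adjugate (expMulC (X : VecField (F.P Kt) 0 (EuclideanSpace ℂ (Fin 3))) (coeField U₀) ⟨p.src, p.ν⟩)).trace / 2)) 0 =
            ℓ₀.comp (fderiv ℂ (fun (X : S) (i : Fin (constrCard (Bj ν.M₁ Z k) k)) =>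
              logCoordC (star ((avgFamily (Node00.avOfRecord F 2 Kt) (qsstarGIter0 k (ext Vk))
                ((constrEnum (Bj ν.M₁ Z k) k).symm i).1 ((constrEnum (Bj ν.M₁ Z k) k).symm i).2.1 : SU2) : Matrix (Fin 2) (Fin 2) ℂ) *
                iterMh ((constrEnum (Bj ν.M₁ Z k) k).symm i).1 (expMulC (X : VecField (F.P Kt) 0 (EuclideanSpace ℂ (Fin 3))) (coeField U₀))
                  ((constrEnum (Bj ν.M₁ Z k) k).symm i).2.1)) 0) →
          ∀ (p : VecField (F.P Kt) 0 E3) (hp : cplxVec p ∈ S), p ≠ 0 →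
            (∀ i : Fin (constrCard (Bj ν.M₁ Z k) k), dIterL ((constrEnum (Bj ν.M₁ Z k) k).symm i).1 (coeField U₀)
              (fun b => (∑ a : Fin 3, ((p b a : ℝ) : ℂ) • genE a) * ((U₀ b : SU2) : Matrix (Fin 2) (Fin 2) ℂ)) ((constrEnum (Bj ν.M₁ Z k) k).symm i).2.1 = 0) →
            0 < deriv (deriv (fun t : ℝ => wilsonAction4 (expMul su2Chart (t • p) U₀) -
              (ℓ₀ ((fun (X : S) (i : Fin (constrCard (Bj ν.M₁ Z k) k)) =>
                logCoordC (star ((avgFamily (Node00.avOfRecord F 2 Kt) (qsstarGIter0 k (ext Vk))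
                  ((constrEnum (Bj ν.M₁ Z k) k).symm i).1 ((constrEnum (Bj ν.M₁ Z k) k).symm i).2.1 : SU2) : Matrix (Fin 2) (Fin 2) ℂ) *
                  iterMh ((constrEnum (Bj ν.M₁ Z k) k).symm i).1 (expMulC (X : VecField (F.P Kt) 0 (EuclideanSpace ℂ (Fin 3))) (coeField U₀))
                    ((constrEnum (Bj ν.M₁ Z k) k).symm i).2.1)) ((t : ℂ) • ⟨cplxVec p, hp⟩))).re)) 0) ∧
      -- DISPLAYED (T1@q₀) over the CLOSURE of NODE 00's class: the tower-central orbit of `U₀` is the unique minimal orbit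
      (∀ U ∈ closure (Node00.regMSCoPOfRecord F 2 ν Kt kc (maxDomT ν.M₁ Z)),
        AgreeOn (Bj ν.M₁ Z k) (avgFamily (Node00.avOfRecord F 2 Kt) U) (avgFamily (Node00.avOfRecord F 2 Kt) (qsstarGIter0 k (ext Vk))) →
        wilsonAction4 U ≤ wilsonAction4 U₀ →
          ∃ u : GaugeTransf (F.P Kt) 0 SU2, (∀ j, j ≤ k → ∀ b ∈ bondsOf (Bj ν.M₁ Z k j),
            toMS u j b.src = toMS u j b.tgt ∧ ∀ g : SU2, toMS u j b.src * g = g * toMS u j b.src) ∧ gaugeAct u U = U₀)) :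
    ∀ K : Set (GaugeField (F.P Kt) k SU2), IsCompact K → (∀ Vk ∈ K, ∀ p ∈ G, dist1 (GaugeField.plaqHol Vk p) ≤ eR) →
    ∃ R : ℝ, 0 < R ∧ ∀ Vk ∈ K,
      ∃ Ũ : VecField (F.P Kt) k (EuclideanSpace ℂ (Fin 3)) × VecField (F.P Kt) k (EuclideanSpace ℂ (Fin 3)) → PBond (F.P Kt) 0 → Matrix (Fin 2) (Fin 2) ℂ,
        (∀ b i j, DifferentiableOn ℂ (fun z => Ũ z b i j) (ball 0 R)) ∧
        (∀ z ∈ ball (0 : VecField (F.P Kt) k (EuclideanSpace ℂ (Fin 3)) × VecField (F.P Kt) k (EuclideanSpace ℂ (Fin 3))) R, ∀ b i j, ‖Ũ z b i j‖ ≤ 𝓐₀) ∧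
        ∀ p B' : VecField (F.P Kt) k E3, ‖p‖ < R → ‖B'‖ < R → ∃ U' : GaugeField (F.P Kt) 0 SU2,
          (∀ b, Ũ (cplxVec p, cplxVec B') b = ((U' b : SU2) : Matrix (Fin 2) (Fin 2) ℂ)) ∧
            IsMinimizer (Node00.avOfRecord F 2 Kt) (Node00.regMSCoPOfRecord F 2 ν Kt kc (maxDomT ν.M₁ Z)) (Bj ν.M₁ Z k)
              (avgFamily (Node00.avOfRecord F 2 Kt) (qsstarGIter0 k (expMul su2Chart B' (ext (expMul su2Chart p Vk))))) U' :=
  fun _ hK hG => hMin_atRecord_Bj_of_printLetters ν Kt kc Z Λ lo hi hk hk1 hkc hdiv hfloor hε hα3 hα2 ext hext hK h𝓐₀ fun Vk hVk => hletters Vk (hG Vk hVk)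


/-- ★★★ **THE SAME, READ ONCE ON THE (COMPACT) CLOSED GUARD — ONE RADIUS FOR ALL GUARDED BASE FIELDS** (dag-n12-c's LOCATED-R recipe «read it ONCE at the compact closed guard and choose the
radius `R i` before stating `hsm`∕`hcJ'`», `B15Prop1ClosedGuardUniformRadius.forall_of_forall_isCompact_subset`): `∃ R > 0, ∀ V_k, (∀ p ∈ G, |V_k(∂p) − 1| ≤ eR) → ∃ Ũ, …`.
[cite: Balaban1989LargeFieldI, (1.74) p.192, Prop. 1 p.194 (last clause); Balaban1985Variational, Thm 1 p.279, (7) p.278, Prop. 9 (190) p.309; Balaban1988Convergent, (2.12)–(2.13) pp.256–257] -/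
theorem hMin_closedGuard_atRecord_Bj_of_printLetters (ν : Node00.Stage7Numerics) (Kt kc : ℕ) (Z : Set (Site (F.P Kt) 0))
    (Λ : Set (Site (F.P Kt) k)) (lo hi : Fin (F.P Kt).d → ℤ) (hk : k ≤ (F.P Kt).m + (F.P Kt).K) (hk1 : 1 ≤ k) (hkc : k ≤ kc + 1)
    (hdiv : side (F.P Kt).L ν.M₁ k ∣ (F.P Kt).sitesPerDir 0) (hfloor : ((F.P Kt).d + 14) * (F.P Kt).L ≤ ν.M₁) (hε : 0 < ν.εreg)
    (hα3 : (143 * (((((F.P Kt).d + 4 : ℕ) : ℝ)) ^ 2 / 4) ^ 2) * (2 * ((F.P Kt).L : ℝ) ^ 2 * ν.εreg) ≤ 1 / 3)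
    (hα2 : 2 * (2 * ((F.P Kt).L : ℝ) ^ 2 * ν.εreg) ≤ 2 * deltaSU (Fin 2) / ((((F.P Kt).d + 4) * (F.P Kt).L : ℕ) : ℝ) ^ 2)
    (ext : GaugeField (F.P Kt) k SU2 → GaugeField (F.P Kt) k SU2) (hext : ∀ W, ext W = extend Λ (shellGauge W lo hi) W)
    {𝓐₀ : ℝ} (h𝓐₀ : 1 < 𝓐₀) (G : Set (Plaq (F.P Kt) k)) (eR : ℝ)
    (hletters : ∀ Vk : GaugeField (F.P Kt) k SU2, (∀ p ∈ G, dist1 (GaugeField.plaqHol Vk p) ≤ eR) → ∃ U₀ : GaugeField (F.P Kt) 0 SU2,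
      IsMinimizer (Node00.avOfRecord F 2 Kt) (Node00.regMSCoPOfRecord F 2 ν Kt kc (maxDomT ν.M₁ Z)) (Bj ν.M₁ Z k)
        (avgFamily (Node00.avOfRecord F 2 Kt) (qsstarGIter0 k (ext Vk))) U₀ ∧
      SmallBelow (Node00.avOfRecord F 2 Kt) k (qsstarGIter0 k (ext Vk)) ∧
      SmallBelow (Node00.avOfRecord F 2 Kt) k U₀ ∧
      -- guards in dag-n12-w3's currency and the DISPLAYED surjectivity of `DΦ_{U₀}(0)`
      (∃ t₀ : ℝ, 0 < t₀ ∧ stokesConst (F.P Kt) * t₀ < deltaSU (Fin 2) ∧ ∀ i, i < k → PlaqSmall t₀ (Averaging.iter (Node00.avOfRecord F 2 Kt) i U₀)) ∧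
      Function.Surjective (fderiv ℝ (Node00.msChart F 2 Kt k (Bj ν.M₁ Z k) (avgFamily (Node00.avOfRecord F 2 Kt) U₀) U₀) 0) ∧
      -- DISPLAYED (β) ON EVERY FOREST AXIAL SLICE through the constrained towers of `𝐁_k(Z)`
      (∀ (S : Submodule ℂ (VecField (F.P Kt) 0 (EuclideanSpace ℂ (Fin 3)))) (path : Site (F.P Kt) 0 → List (LStep (F.P Kt) 0)),
        (∀ x, ∀ s ∈ path x, ∃ x' x'' : Site (F.P Kt) 0, path x'' = path x' ++ [s] ∧
          (s.fwd = true → s.bond.src = x' ∧ s.bond.tgt = x'') ∧ (s.fwd = false → s.bond.src = x'' ∧ s.bond.tgt = x')) →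
        (∀ j, j ≤ k → ∀ c ∈ bondsOf (Bj ν.M₁ Z k j), path (embIter j c.src) = [] ∧ path (embIter j c.tgt) = []) →
        (∀ X : VecField (F.P Kt) 0 (EuclideanSpace ℂ (Fin 3)), X ∈ S ↔ ∀ x, ∀ s ∈ path x, X s.bond = 0) →
        ∀ ℓ₀ : (Fin (constrCard (Bj ν.M₁ Z k) k) → EuclideanSpace ℂ (Fin 3)) →L[ℂ] ℂ,
          fderiv ℂ (fun X : S => ∑ p : Plaq (F.P Kt) 0, (1 - (expMulC (X : VecField (F.P Kt) 0 (EuclideanSpace ℂ (Fin 3))) (coeField U₀) ⟨p.src, p.μ⟩ *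
            expMulC (X : VecField (F.P Kt) 0 (EuclideanSpace ℂ (Fin 3))) (coeField U₀) ⟨p.src.shift p.μ, p.ν⟩ *
            Matrix.adjugate (expMulC (X : VecField (F.P Kt) 0 (EuclideanSpace ℂ (Fin 3))) (coeField U₀) ⟨p.src.shift p.ν, p.μ⟩) *
            Matrix.adjugate (expMulC (X : VecField (F.P Kt) 0 (EuclideanSpace ℂ (Fin 3))) (coeField U₀) ⟨p.src, p.ν⟩)).trace / 2)) 0 =
            ℓ₀.comp (fderiv ℂ (fun (X : S) (i : Fin (constrCard (Bj ν.M₁ Z k) k)) =>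
              logCoordC (star ((avgFamily (Node00.avOfRecord F 2 Kt) (qsstarGIter0 k (ext Vk))
                ((constrEnum (Bj ν.M₁ Z k) k).symm i).1 ((constrEnum (Bj ν.M₁ Z k) k).symm i).2.1 : SU2) : Matrix (Fin 2) (Fin 2) ℂ) *
                iterMh ((constrEnum (Bj ν.M₁ Z k) k).symm i).1 (expMulC (X : VecField (F.P Kt) 0 (EuclideanSpace ℂ (Fin 3))) (coeField U₀))
                  ((constrEnum (Bj ν.M₁ Z k) k).symm i).2.1)) 0) →
          ∀ (p : VecField (F.P Kt) 0 E3) (hp : cplxVec p ∈ S), p ≠ 0 →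
            (∀ i : Fin (constrCard (Bj ν.M₁ Z k) k), dIterL ((constrEnum (Bj ν.M₁ Z k) k).symm i).1 (coeField U₀)
              (fun b => (∑ a : Fin 3, ((p b a : ℝ) : ℂ) • genE a) * ((U₀ b : SU2) : Matrix (Fin 2) (Fin 2) ℂ)) ((constrEnum (Bj ν.M₁ Z k) k).symm i).2.1 = 0) →
            0 < deriv (deriv (fun t : ℝ => wilsonAction4 (expMul su2Chart (t • p) U₀) -
              (ℓ₀ ((fun (X : S) (i : Fin (constrCard (Bj ν.M₁ Z k) k)) =>
                logCoordC (star ((avgFamily (Node00.avOfRecord F 2 Kt) (qsstarGIter0 k (ext Vk))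
                  ((constrEnum (Bj ν.M₁ Z k) k).symm i).1 ((constrEnum (Bj ν.M₁ Z k) k).symm i).2.1 : SU2) : Matrix (Fin 2) (Fin 2) ℂ) *
                  iterMh ((constrEnum (Bj ν.M₁ Z k) k).symm i).1 (expMulC (X : VecField (F.P Kt) 0 (EuclideanSpace ℂ (Fin 3))) (coeField U₀))
                    ((constrEnum (Bj ν.M₁ Z k) k).symm i).2.1)) ((t : ℂ) • ⟨cplxVec p, hp⟩))).re)) 0) ∧
      -- DISPLAYED (T1@q₀) over the CLOSURE of NODE 00's class: the tower-central orbit of `U₀` is the unique minimal orbit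
      (∀ U ∈ closure (Node00.regMSCoPOfRecord F 2 ν Kt kc (maxDomT ν.M₁ Z)),
        AgreeOn (Bj ν.M₁ Z k) (avgFamily (Node00.avOfRecord F 2 Kt) U) (avgFamily (Node00.avOfRecord F 2 Kt) (qsstarGIter0 k (ext Vk))) →
        wilsonAction4 U ≤ wilsonAction4 U₀ →
          ∃ u : GaugeTransf (F.P Kt) 0 SU2, (∀ j, j ≤ k → ∀ b ∈ bondsOf (Bj ν.M₁ Z k j),
            toMS u j b.src = toMS u j b.tgt ∧ ∀ g : SU2, toMS u j b.src * g = g * toMS u j b.src) ∧ gaugeAct u U = U₀)) :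
    ∃ R : ℝ, 0 < R ∧ ∀ Vk : GaugeField (F.P Kt) k SU2, (∀ p ∈ G, dist1 (GaugeField.plaqHol Vk p) ≤ eR) →
      ∃ Ũ : VecField (F.P Kt) k (EuclideanSpace ℂ (Fin 3)) × VecField (F.P Kt) k (EuclideanSpace ℂ (Fin 3)) → PBond (F.P Kt) 0 → Matrix (Fin 2) (Fin 2) ℂ,
        (∀ b i j, DifferentiableOn ℂ (fun z => Ũ z b i j) (ball 0 R)) ∧
        (∀ z ∈ ball (0 : VecField (F.P Kt) k (EuclideanSpace ℂ (Fin 3)) × VecField (F.P Kt) k (EuclideanSpace ℂ (Fin 3))) R, ∀ b i j, ‖Ũ z b i j‖ ≤ 𝓐₀) ∧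
        ∀ p B' : VecField (F.P Kt) k E3, ‖p‖ < R → ‖B'‖ < R → ∃ U' : GaugeField (F.P Kt) 0 SU2,
          (∀ b, Ũ (cplxVec p, cplxVec B') b = ((U' b : SU2) : Matrix (Fin 2) (Fin 2) ℂ)) ∧
            IsMinimizer (Node00.avOfRecord F 2 Kt) (Node00.regMSCoPOfRecord F 2 ν Kt kc (maxDomT ν.M₁ Z)) (Bj ν.M₁ Z k)
              (avgFamily (Node00.avOfRecord F 2 Kt) (qsstarGIter0 k (expMul su2Chart B' (ext (expMul su2Chart p Vk))))) U' :=
  forall_of_forall_isCompact_subset G eR (fun R Vk => 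
      ∃ Ũ : VecField (F.P Kt) k (EuclideanSpace ℂ (Fin 3)) × VecField (F.P Kt) k (EuclideanSpace ℂ (Fin 3)) → PBond (F.P Kt) 0 → Matrix (Fin 2) (Fin 2) ℂ,
        (∀ b i j, DifferentiableOn ℂ (fun z => Ũ z b i j) (ball 0 R)) ∧
        (∀ z ∈ ball (0 : VecField (F.P Kt) k (EuclideanSpace ℂ (Fin 3)) × VecField (F.P Kt) k (EuclideanSpace ℂ (Fin 3))) R, ∀ b i j, ‖Ũ z b i j‖ ≤ 𝓐₀) ∧
        ∀ p B' : VecField (F.P Kt) k E3, ‖p‖ < R → ‖B'‖ < R → ∃ U' : GaugeField (F.P Kt) 0 SU2,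
          (∀ b, Ũ (cplxVec p, cplxVec B') b = ((U' b : SU2) : Matrix (Fin 2) (Fin 2) ℂ)) ∧
            IsMinimizer (Node00.avOfRecord F 2 Kt) (Node00.regMSCoPOfRecord F 2 ν Kt kc (maxDomT ν.M₁ Z)) (Bj ν.M₁ Z k)
              (avgFamily (Node00.avOfRecord F 2 Kt) (qsstarGIter0 k (expMul su2Chart B' (ext (expMul su2Chart p Vk))))) U')
    (hMinC_atRecord_Bj_of_printLetters ν Kt kc Z Λ lo hi hk hk1 hkc hdiv hfloor hε hα3 hα2 ext hext h𝓐₀ G eR hletters)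

end Summit.QuantumFields.YangMills.BalabanUVNodes.N12MinimiserFamilyAtRecordBj

end
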